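import Summits.AtomisticToContinuum.HydrodynamicLimit.Theses.CollisionIsometryCLT
import Summits.AtomisticToContinuum.HydrodynamicLimit.Theses.ImplosionDichotomy

/-!
# Crux MacroClosure (stmt-AtomisticToContinuum-14670) — ideator 2, round 1: first lemmas

Sketch file of planner-cruxidea-stmt-AtomisticToContinuum-14670-2-0.  Three checkable statements:

* `MacroClosureInBand` + `macroClosure_of_inBand` — the SHAPE every line of this ideator takes: an
  in-band engine (the three closure hypotheses ⇒ the packing-guarded conjunct `HydroLimitInBand`,
  stmt-9133) plus the shared Euler-side input `DiluteSelfConsistency` (stmt-3091) conclude the crux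
  decl `CollisionIsometryCLT.MacroClosure` BY NAME (proved, pure logic via `ImplosionDichotomy.closes`).
* `LedgerIdentity` — card `entropy-ledger-gronwall`: the exact finite-`N` entropy ledger
  (Liouville invariance of Shannon entropy + log-linearity of hard-sphere local Gibbs densities in the
  empirical measure): Yau's relative entropy of the evolved law against ANY local Gibbs reference is a
  difference of two "mean log-profile minus specific log-partition" brackets.
* `SurrogateExcessFreeEnergy` — card `surrogate-thermo-subunit-tilt`: a one-sided (below the true
  `f_ex`), compactly switched-off, smooth surrogate of the excess free energy that agrees with it on the
  virial window and makes `η log η + η f̃(η)` uniformly convex on the whole particle chamber.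
-/

noncomputable section

open MeasureTheory Filter Set Topology
open scoped ENNReal

namespace Summit.AtomisticToContinuum.HydrodynamicLimit.Cruxes.MacroClosure.IdeatorTwo

open Literature.MathematicalPhysics.KineticTheory Literature.Analysis.FluidPDE
open Summit.AtomisticToContinuum.HydrodynamicLimit.Theses

/-- SHAPE. The packing-guarded form of the crux: the three particle-side closure inputs give the
packing-guarded conjunct `HydroLimitInBand` (∃ η₀ outermost). -/
def MacroClosureInBand : Prop :=
  CollisionIsometryCLT.CollisionalTransferLocality → CollisionIsometryCLT.AprioriBounds →
    CollisionIsometryCLT.FastMomentRelaxation → ImplosionDichotomy.HydroLimitInBand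

/-- TRANSFER (pure logic, proved): in-band engine + dilute self-consistency of admissible classical
solutions ⇒ the crux `MacroClosure` by name. -/
theorem macroClosure_of_inBand (hD : ImplosionDichotomy.DiluteSelfConsistency)
    (hB : MacroClosureInBand) : CollisionIsometryCLT.MacroClosure :=
  fun h₂ h₃ hF => ImplosionDichotomy.closes hD (hB h₂ h₃ hF)

/-- CARD `entropy-ledger-gronwall`, first lemma (finite `N`, exact; provable now up to the `klDiv` /
`lawAt_withDensity` API): for two local Gibbs laws `P₀ = ψ[a₀,u₀,θ₀]`, `ψ = ψ[a₁,u₁,θ₁]` of the same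
`N + 1` spheres at reduced diameter `σ`, and the law `P_t = (Φ_t)_# P₀` of the deterministically
evolved gas,
`H(P_t | ψ)/(N+1) = [E_{P₀}⟨emp, log prof₀⟩ − Π_N(prof₀)] − [E_{P_t}⟨emp, log prof₁⟩ − Π_N(prof₁)]`,
`lp = Π_N = (N+1)⁻¹ log canonicalPartition`, `⟨emp, g⟩ = ∫ g d(empiricalMeasure z)`.
(Shannon entropy of `P_t` w.r.t. Liouville is that of `P₀`; `log ψ` is `(N+1)⟨emp, log prof₁⟩ − log Z₁`
on the hard-sphere domain.)  With `ψ` fitted to the classical Euler state at time `t` and the statics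
of local Gibbs laws, the right-hand side is `∫ Λ_cl(t,x)·(U_cl(t,x) − E_{P_t} Ū_N(t,x)) dx + o(1)`:
Yau's functional is a LINEAR statistic of the mean fields — the Gronwall variable of the line. -/
def LedgerIdentity : Prop :=
  ∀ (σ : ℝ) (N : ℕ)
    (Φ : HardSphereFlow (Torus.geometry (Fin 3)) (hsDiameter σ N) (N + 1))
    (a₀ θ₀ a₁ θ₁ : T3 → ℝ) (u₀ u₁ : T3 → V3) (t : ℝ),
    Continuous a₀ → Continuous θ₀ → Continuous u₀ → Continuous a₁ → Continuous θ₁ →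
    Continuous u₁ → (∀ x, 0 < a₀ x) → (∀ x, 0 < θ₀ x) → (∀ x, 0 < a₁ x) → (∀ x, 0 < θ₁ x) →
    IsProbabilityMeasure (localGibbsLaw σ a₀ u₀ θ₀ N Φ) →
    IsProbabilityMeasure (localGibbsLaw σ a₁ u₁ θ₁ N Φ) →
    let P₀ := localGibbsLaw σ a₀ u₀ θ₀ N Φ
    let ψ := localGibbsLaw σ a₁ u₁ θ₁ N Φ
    let lp : (T3 → ℝ) → (T3 → V3) → (T3 → ℝ) → ℝ := fun a u θ =>
      ((N : ℝ) + 1)⁻¹ * Real.log (canonicalPartition (Torus.geometry (Fin 3)) (hsDiameter σ N)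
        (N + 1) (localGibbsProfile a u θ))
    let pair : (T3 → ℝ) → (T3 → V3) → (T3 → ℝ) → Config (N + 1) (Fin 3) T3 → ℝ :=
      fun a u θ z => ∫ y, Real.log (localGibbsProfile a u θ y) ∂(empiricalMeasure z)
    (InformationTheory.klDiv (Φ.lawAt P₀ t) ψ).toReal / ((N : ℝ) + 1) =
      ((∫ z, pair a₀ u₀ θ₀ z ∂P₀) - lp a₀ u₀ θ₀) -
        ((∫ z, pair a₁ u₁ θ₁ z ∂(Φ.lawAt P₀ t)) - lp a₁ u₁ θ₁)

/-- CARD `surrogate-thermo-subunit-tilt`, first lemma (real analysis over the PROVED low-density fact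
`HsEosLowDensity`, stmt-0768): a `C³` surrogate `f` of `hsExcessFreeEnergy` that (i) equals it on a
virial window `[0, η₁]`, (ii) never exceeds it on `[0, ∞)`, (iii) vanishes (ideal gas) beyond `2η₁`,
(iv) is non-negative on `[0, ∞)`, and (v) makes the configurational free energy `η log η + η f(η)` uniformly convex
(modulus `1/4`) on `(0, 2] ⊃` the particle chamber `ρ̄σ³ ≤ 1`.  Construction: `f = F · ψ` with `F` the
analytic germ of `HsEosLowDensity` and `ψ` a smooth cut-off switching off on `[η₁/2…]`; `1/η`
dominates `2f' + η f''` for `η₁` small. -/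
def SurrogateExcessFreeEnergy : Prop :=
  ImplosionDichotomy.HsEosLowDensity →
    ∃ η₁ : ℝ, 0 < η₁ ∧ ∃ f : ℝ → ℝ, ContDiff ℝ 3 f ∧
      Set.EqOn f hsExcessFreeEnergy (Set.Icc 0 η₁) ∧
      (∀ η, 0 ≤ η → f η ≤ hsExcessFreeEnergy η) ∧
      (∀ η, 2 * η₁ ≤ η → f η = 0) ∧ (∀ η, 0 ≤ η → 0 ≤ f η) ∧
      ConvexOn ℝ (Set.Ioc 0 2) (fun η => η * Real.log η + η * f η - η ^ 2 / 8)

end Summit.AtomisticToContinuum.HydrodynamicLimit.Cruxes.MacroClosure.IdeatorTwo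

end
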